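import Literature.Computability.Cryptography.CubicClassTable
import Literature.Computability.Cryptography.CubicClassPost
import HarnessLib

/-!
# The class-group stage of the pure cubic class-number algorithm: the choice of parameters (definitions)

Topic `Computability/Cryptography`; DEFINITIONS ONLY, companion of `CubicClassTable.lean` (`Inst`), `CubicClassPost.lean`
(`PostParams`) and `CubicClassSamplingSpecs.lean` (the part statements `ClaimTableSem`, `ClaimSamplingLaw`, `ClaimPost`).
The assembly of the class-group stage of the crux `LinnikCubicClassGroups.PureCubicClassGroupFBQP` (line
`arakelov-giant-step-cycle`) must choose, as EXPLICIT polynomial-size functions of the input `w = ⟨x, ⟨⟨f,a,b⟩, ps⟩⟩`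
(length `n`, radicand `m = decodeNat x = f³ab²`) and of the regulator advice `r ≈ 2^k R_K`, every layout / walk / sampling
parameter so that simultaneously (i) the table's structural interface applies (`ClassTableInterfaceQ3`: advice precision
`k`, working precision `prec`, grid `2^s`, digits `ℓe`, coins `ℓb, ℓκ`, ladder `s₀, Tdbl, Bb`, clamp `cap`), (ii) the
harmonic analysis applies (`ClaimSamplingLaw`: window `u`, slice window `K₀`, precision knob `e₆`, class-number bound
`hB = (27m²)^10`), (iii) the post-processing applies (`ClaimPost`: `(4K₀+2)·δ·B² < 1`) and (iv) the three error terms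
(Kitaev accuracy over `1600 (Z+4)²` units, inaccurate units, non-generation) stay below `1/64` each. This file fixes that
choice once (`npp = 0`, `ℓy = s`, `margin = 0`, `Bfin = 0`, `e = 2 e₆`):

* `Z n = 2^17 (n+8)³` — the padded length of the family's input string (so the block length `(Z+1)²` covers the layout);
* `e6`, `LB` (bit bound of `hB`), `LD`, `KN`, `hB`, `sOf`, `Tp`, `uOf`, `leOf`, `K0Of`, `capOf`, `lbOf`, `lkOf`, `kOf`,
  `precOf`, `topOf`;
* `theInst n a b ps ord r : CubicClassTable.Inst` (with `Inst.m = a b²`: the cube roots fed to the prime codes are roots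
  of `ab²`), `postP n a b mx ps : CubicClassPost.PostParams`.
[Hallgren 2005, §4]

## References

* S. Hallgren, STOC 2005, §4. [Hallgren2005]
* A. Yu. Kitaev, arXiv:quant-ph/9511026 (1995), §4. [Kitaev1995]
-/

namespace Literature.Computability.Cryptography

namespace CubicClassStageParams

/-- **The padded input length** of the sampling experiment on inputs of length `n`. [folklore] -/
def Z (n : ℕ) : ℕ := 2 ^ 17 * (n + 8) ^ 3

/-- **The precision knob** `e₆ = 2 size(Z + 4) + 20` (all per-unit error terms are `≤ 2^-e₆`; `2·800(Z+4)²·2^(1−e₆) ≤ 1/64`).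
[folklore] -/
def e6 (n : ℕ) : ℕ := 2 * Nat.size (Z n + 4) + 20

/-- **Bit bound of the class-number bound**: `log₂ hB + 2 ≤ LB = 20 n + 75` (`hB = (27 m²)^10`, `m < 2^(n+1)`). [folklore] -/
def LB (n : ℕ) : ℕ := 20 * n + 75

/-- `LD = size (27 a² b²)` (so `|d_K| < 2^LD`). [folklore] -/
def LD (a b : ℕ) : ℕ := Nat.size (27 * a ^ 2 * b ^ 2)

/-- `KN = 10 size(ab) + 48` (the per-product defect bound is `2^prec · KN`). [folklore] -/
def KN (a b : ℕ) : ℕ := 10 * Nat.size (a * b) + 48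

/-- **The class-number bound** `hB = (27 m²)^10 ≥ h(K) ≥ |⟨degree-one primes⟩|`. [cite: Hallgren2005, §4] -/
def hB (mx : ℕ) : ℕ := (27 * mx ^ 2) ^ 10

/-- **The grid exponent** `s = 6 LD + LB + 2 e₆ + 60` (`2^s` grid points per period; `ℓy = s`, `npp = 0`). [folklore] -/
def sOf (n a b : ℕ) : ℕ := 6 * LD a b + LB n + 2 * e6 n + 60

/-- The number of generator slots `T = 3 |ps|`. [folklore] -/
def Tp (ps : List ℕ) : ℕ := 3 * ps.length

/-- **The window half-width** `u = 2^(e₆+8) · hB · (T + 1)`. [folklore] -/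
def uOf (n mx : ℕ) (ps : List ℕ) : ℕ := 2 ^ (e6 n + 8) * hB mx * (Tp ps + 1)

/-- **The digit size** `ℓe = 3 LB + (T+1)(e₆ + 10 + LB + size(T+1)) + s + e₆ + 40` (so `hB³ (2u)^T 2^(s+e₆+40) ≤ 2^ℓe`).
[folklore] -/
def leOf (n a b : ℕ) (ps : List ℕ) : ℕ :=
  3 * LB n + (Tp ps + 1) * (e6 n + 10 + LB n + Nat.size (Tp ps + 1)) + sOf n a b + e6 n + 40

/-- **The slice window** `K₀ = ⌊2^s / (2^(e₆+8) hB)⌋`. [folklore] -/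
def K0Of (n a b mx : ℕ) : ℕ := 2 ^ sOf n a b / (2 ^ (e6 n + 8) * hB mx)

/-- **The clamp cap** `(243 a² b² (pmax + 1))²`. [folklore] -/
def capOf (a b : ℕ) (ps : List ℕ) : ℕ := (243 * a ^ 2 * b ^ 2 * (ps.foldr max 0 + 1)) ^ 2

/-- **Coins per prime** `ℓb = 24 (size cap + 2) (50 + 2 e₆ + size |ps|)`. [folklore] -/
def lbOf (n a b : ℕ) (ps : List ℕ) : ℕ := 24 * (Nat.size (capOf a b ps) + 2) * (50 + 2 * e6 n + Nat.size ps.length)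

/-- **Coin block** `ℓκ = |ps| ℓb`. [folklore] -/
def lkOf (n a b : ℕ) (ps : List ℕ) : ℕ := ps.length * lbOf n a b ps

/-- **The advice precision** `k = ℓe + s + 60 + 6 LD + 2 e₆ + 2 size |ps|` (regulator advice `|r − 2^k R_K| ≤ 1`).
[cite: Hallgren2005, §4] -/
def kOf (n a b : ℕ) (ps : List ℕ) : ℕ := leOf n a b ps + sOf n a b + 60 + 6 * LD a b + 2 * e6 n + 2 * Nat.size ps.length

/-- **The working precision** `prec = k + s + 64`. [folklore] -/
def precOf (n a b : ℕ) (ps : List ℕ) : ℕ := kOf n a b ps + sOf n a b + 64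

/-- **The bits above the grid block**: `top = (Z+1)² − s − ℓe·T` (coins and padding; the block length is `(Z+1)²`).
[folklore] -/
def topOf (n a b : ℕ) (ps : List ℕ) : ℕ := (Z n + 1) ^ 2 - sOf n a b - leOf n a b ps * Tp ps

/-- **The instance of the class table** on input data `(a, b, ps)`, order code `ord`, advice `r` and input length `n`
(`m := a b²`, `npp := 0`, `ℓy := s`, `s₀ := 18 KN`, `Tdbl := 6 LD + 16`, `Bfin := 0`, `Bb := 32 KN²`, `margin := 0`).
[cite: Hallgren2005, §4] -/
def theInst (n a b : ℕ) (ps : List ℕ) (ord : ℕ × List ℤ) (r : ℕ) : CubicClassTable.Inst :=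
  ⟨a, b, a * b ^ 2, ps, ord, r, kOf n a b ps, precOf n a b ps, sOf n a b, leOf n a b ps, 0, sOf n a b, lkOf n a b ps,
    lbOf n a b ps, 18 * KN a b, 6 * LD a b + 16, 0, 32 * KN a b ^ 2, 0⟩

/-- **The post-processor parameters** (`T = 3|ps|`, `ℓe`, `s`, `aexp = 0`, `top`, `K₀`, `B = hB`). [cite: Hallgren2005, §4] -/
def postP (n a b mx : ℕ) (ps : List ℕ) : CubicClassPost.PostParams :=
  ⟨Tp ps, leOf n a b ps, sOf n a b, 0, topOf n a b ps, K0Of n a b mx, hB mx⟩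

end CubicClassStageParams

end Literature.Computability.Cryptography
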